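import Summits.CriticalPhenomena.PercolationContinuityZ3.Theorems.PercNearOneGluingNoHeavyLowerTailSahiCTCLadderSupplyGeneralType
import HarnessLib

/-!
# `NoHeavyLowerTail` (crux stmt-CriticalPhenomena-4575), P3 lane: pinned supply of a cube TYPE (general row)

Support file (seat `prim-l12-p3`, gen 26; `--supports stmt-CriticalPhenomena-4575`).  README blueprint step 2, general form, last part:
summing `cube_pinned_supply` over the cubes `(A, Y)` of type `i` and the pinned points `p ∈ A` (`type_pinned_supply`):
`cH(ℓ+1,n)C(n,ℓ+1) · Σ_c Σ_j (i+j−#D)·#kindsIn_j(c) + cH(ℓ,n)C(n,ℓ) · Σ_c Σ_j (#D−j)·#kindsIn_j(c) ≤ C(n,ℓ)C(n,ℓ+1) · i · Σ_c κ(c)`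
(`ℓ + 1 = t − (#D − i)`, `n + 1 = i + (#T − (t − i))`, `2(ℓ+1) ≤ n+1`).  With `type_plain_supply`, `sum_card_kindsIn` and
`coeff_chargeT_le_kinds` / `cubes_le_coeff_ee_mul_harris_general` every row of `(L_t)` is reduced to arithmetic.  Nothing is asserted
about the crux.
-/

namespace Summit.CriticalPhenomena.PercolationContinuityZ3.Theorems.SahiCTCForms

open Finset MvPolynomial SahiCTCGenFun SahiCTCWeightedLYM

variable {α : Type*} [DecidableEq α] [Fintype α]

section SupplyGeneralTypePinned
variable {𝒳 𝒵 : Finset (Finset α)}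

omit [Fintype α] in
/-- **Pinned supply of a cube type** (see the module docstring). [this work] -/
theorem type_pinned_supply (h𝒳 : IsUpperSet (𝒳 : Set (Finset α))) (h𝒵 : IsUpperSet (𝒵 : Set (Finset α))) {t : ℕ}
    (hXt : ∀ S ∈ 𝒳, t ≤ #S) (hZt : ∀ S ∈ 𝒵, t ≤ #S) {m : α →₀ ℕ} (hδt : #(dbl m) ≤ t) {i ℓ n : ℕ}
    (hℓ : ℓ + 1 + (#(dbl m) - i) = t) (hn : i + (#(lev m 1) - (t - i)) = n + 1) (h2 : 2 * (ℓ + 1) ≤ n + 1) :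
    ((cH (ℓ + 1) n * n.choose (ℓ + 1) : ℕ) : ℤ) *
        ∑ c ∈ (dbl m).powersetCard i ×ˢ (lev m 1).powersetCard (t - i),
          ∑ j ∈ range (#(dbl m) + 1), (((i + j - #(dbl m)) * #(kindsIn 𝒳 𝒵 m t j c.1 c.2) : ℕ) : ℤ)
      + ((cH ℓ n * n.choose ℓ : ℕ) : ℤ) *
        ∑ c ∈ (dbl m).powersetCard i ×ˢ (lev m 1).powersetCard (t - i),
          ∑ j ∈ range (#(dbl m) + 1), (((#(dbl m) - j) * #(kindsIn 𝒳 𝒵 m t j c.1 c.2) : ℕ) : ℤ)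
      ≤ ((n.choose ℓ * n.choose (ℓ + 1) : ℕ) : ℤ) * (i : ℤ) *
        ∑ c ∈ (dbl m).powersetCard i ×ˢ (lev m 1).powersetCard (t - i), kap 𝒳 𝒵 (dbl m \ c.1) (c.1 ∪ (lev m 1 \ c.2)) := by
  rw [mul_sum, mul_sum, mul_sum, ← sum_add_distrib]
  refine sum_le_sum fun c hc => ?_
  obtain ⟨hF, hB, hAD⟩ := card_free_of_type hc
  have hAc : #c.1 = i := (mem_powersetCard.1 (mem_product.1 hc).1).2
  have hℓ' : ℓ + 1 + #(dbl m \ c.1) = t := by rw [hB]; omega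
  have hF' : #(c.1 ∪ (lev m 1 \ c.2)) = n + 1 := by rw [hF, hn]
  -- per pinned point
  have hp : ∀ p ∈ c.1,
      ((cH (ℓ + 1) n * n.choose (ℓ + 1) : ℕ) : ℤ) *
          ∑ j ∈ range (#(dbl m) + 1), (#((kindsIn 𝒳 𝒵 m t j c.1 c.2).filter fun q => p ∈ q.1) : ℤ)
        + ((cH ℓ n * n.choose ℓ : ℕ) : ℤ) *
          ∑ j ∈ range (#(dbl m) + 1), (#((kindsIn 𝒳 𝒵 m t j c.1 c.2).filter fun q => p ∉ q.1) : ℤ)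
        ≤ ((n.choose ℓ * n.choose (ℓ + 1) : ℕ) : ℤ) * kap 𝒳 𝒵 (dbl m \ c.1) (c.1 ∪ (lev m 1 \ c.2)) :=
    fun p hp => cube_pinned_supply h𝒳 h𝒵 hXt hZt hAD hδt hp hℓ' hF' h2
  have hsum := sum_le_sum hp
  rw [sum_const, nsmul_eq_mul, hAc, sum_add_distrib, ← mul_sum, ← mul_sum, sum_comm] at hsum
  -- the pinned weights
  have hin : ∑ j ∈ range (#(dbl m) + 1), ∑ p ∈ c.1, (#((kindsIn 𝒳 𝒵 m t j c.1 c.2).filter fun q => p ∈ q.1) : ℤ)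
      = ∑ j ∈ range (#(dbl m) + 1), (((i + j - #(dbl m)) * #(kindsIn 𝒳 𝒵 m t j c.1 c.2) : ℕ) : ℤ) := by
    refine sum_congr rfl fun j _ => ?_
    have := sum_card_kindsIn_filter_mem (𝒳 := 𝒳) (𝒵 := 𝒵) (t := t) (j := j) (Y := c.2) hAD
    rw [hAc] at this
    exact_mod_cast this
  have hout : ∑ j ∈ range (#(dbl m) + 1), ∑ p ∈ c.1, (#((kindsIn 𝒳 𝒵 m t j c.1 c.2).filter fun q => p ∉ q.1) : ℤ)
      = ∑ j ∈ range (#(dbl m) + 1), (((#(dbl m) - j) * #(kindsIn 𝒳 𝒵 m t j c.1 c.2) : ℕ) : ℤ) := by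
    refine sum_congr rfl fun j _ => ?_
    have := sum_card_kindsIn_filter_not_mem (𝒳 := 𝒳) (𝒵 := 𝒵) (t := t) (j := j) (Y := c.2) hAD
    exact_mod_cast this
  have hsum' : ((cH (ℓ + 1) n * n.choose (ℓ + 1) : ℕ) : ℤ) *
        ∑ j ∈ range (#(dbl m) + 1), ∑ p ∈ c.1, (#((kindsIn 𝒳 𝒵 m t j c.1 c.2).filter fun q => p ∈ q.1) : ℤ)
      + ((cH ℓ n * n.choose ℓ : ℕ) : ℤ) *
        ∑ j ∈ range (#(dbl m) + 1), ∑ p ∈ c.1, (#((kindsIn 𝒳 𝒵 m t j c.1 c.2).filter fun q => p ∉ q.1) : ℤ)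
      ≤ (i : ℤ) * (((n.choose ℓ * n.choose (ℓ + 1) : ℕ) : ℤ) * kap 𝒳 𝒵 (dbl m \ c.1) (c.1 ∪ (lev m 1 \ c.2))) := by
    have e2 : ∑ p ∈ c.1, ∑ j ∈ range (#(dbl m) + 1), (#((kindsIn 𝒳 𝒵 m t j c.1 c.2).filter fun q => p ∉ q.1) : ℤ)
        = ∑ j ∈ range (#(dbl m) + 1), ∑ p ∈ c.1, (#((kindsIn 𝒳 𝒵 m t j c.1 c.2).filter fun q => p ∉ q.1) : ℤ) := sum_comm
    rw [e2] at hsum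
    exact_mod_cast hsum
  rw [hin, hout] at hsum'
  linarith only [hsum']

end SupplyGeneralTypePinned

end Summit.CriticalPhenomena.PercolationContinuityZ3.Theorems.SahiCTCForms
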